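import Literature.AlgebraicGeometry.Morphisms.TwoPieceImage
import Literature.AlgebraicGeometry.Morphisms.RefinedValuativeCriterionDense
import Literature.AlgebraicGeometry.Resolution.GluingAfterBlowup
import Mathlib.AlgebraicGeometry.Noetherian
import HarnessLib

/-!
# The two-piece compactification lemma (Stacks 0F40), conditional on Raynaud–Gruson flattening

Topic: `Literature/AlgebraicGeometry/Morphisms`. The Stacks Project, Tag 0F40 (More on Flatness,
Lemma 38.33.7): "Let `S` be a Noetherian scheme. Let `U` be a scheme of finite type and separated
over `S`. Let `U = U₁ ∪ U₂` be opens such that `U₁` and `U₂` have compactifications over `S` and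
such that `U₁ ∩ U₂` is dense in `U`. Then `U` has a compactification over `S`." This is the
induction step of the Noetherian case of Nagata's compactification theorem (Tag 0F41; the named
fact `Literature.AlgebraicGeometry.Morphisms.NagataCompactification`, whose Noetherian assembly
from this lemma is `exists_compactification_of_isNoetherian_of_twoPiece` in
`NagataCompactification.lean`).

PROVED here, conditionally on the named fact `Resolution.Stacks081R` (Raynaud–Gruson flattening
by blowing up — the ONLY undischarged input, entering through Tags 081S/0F3W/0F3X/0F3Z), by the
printed proof: extension data `Xᵢ ⊇ Vᵢ → U` (Tag 0F3Z, `ExtData`), the reductions making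
`X₁₂ ∩ (Z̄₁,₂ ×_S Z̄₂,₁) = ∅` (Tags 0F3V, 0F3W, 0F3Y: `ExtData.exists_goodPair`), the separated
pieces `Wᵢ = U ⨿_{Uᵢ} (Xᵢ ∖ Z̄ᵢ,ⱼ)` (Tag 0F3U: `ExtData.piece`), the valuative lifting
`Spec A → Wᵢ` ("for any valuation ring `A` over `S` with fraction field `K` and any morphism
`γ : Spec(K) → U₁ ∩ U₂` over `S`, there is an `i` and an extension of `γ` to a morphism
`hᵢ : Spec(A) → Wᵢ`" — by the valuative criterion for the proper `Xᵢ → S` and the emptiness),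
Tag 0F3X (`Resolution.stacks0F3X_of_stacks081R`: `W`), lifting further along the proper blowing
ups `Wᵢ' → Wᵢ`, and the refined valuative criterion Tag 0894 with `U₁ ∩ U₂ → W` of dense image
(`isProper_of_valuativeCriterion_comp_of_denseRange`).

* `exists_lift_of_universallyClosed` — extracting a lift from the valuative criterion;
* `exists_compactification_of_twoPiece_of_stacks081R` — **Stacks 0F40** (`S` Noetherian);
* `h0F40_of_stacks081R` — the same in the shape of the hypothesis `h0F40` of
  `exists_compactification_of_isNoetherian_of_twoPiece`, over a Noetherian base.

## References

* The Stacks Project, Tag 0F40 (Lemma 38.33.7), proof; Tags 0F3U, 0F3V, 0F3W, 0F3X, 0F3Y, 0F3Z,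
  0894. [StacksProject]
-/

noncomputable section

-- Mathlib's pull-back API is stated through `abbrev`s over `limit`; as in Mathlib's own
-- algebraic-geometry files we let `simp`/unification see through them.
set_option backward.isDefEq.respectTransparency false

universe u

open CategoryTheory CategoryTheory.Limits AlgebraicGeometry TopologicalSpace
open Literature.AlgebraicGeometry.Resolution

namespace Literature.AlgebraicGeometry.Morphisms

/-! ## Generalities -/

/-- **A lift of a valuative square along a universally closed morphism** (the existence half of
the valuative criterion, Mathlib `UniversallyClosed.eq_valuativeCriterion`, unpacked).
[cite: StacksProject, Tag 01KF] -/
theorem exists_lift_of_universallyClosed {X Y : Scheme.{u}} (f : X ⟶ Y) [UniversallyClosed f]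
    {A K : Type u} [CommRing A] [IsDomain A] [ValuationRing A] [Field K] [Algebra A K]
    [IsFractionRing A K] (i₁ : Spec (.of K) ⟶ X) (i₂ : Spec (.of A) ⟶ Y)
    (w : i₁ ≫ f = Spec.map (CommRingCat.ofHom (algebraMap A K)) ≫ i₂) :
    ∃ l : Spec (.of A) ⟶ X, Spec.map (CommRingCat.ofHom (algebraMap A K)) ≫ l = i₁ ∧ l ≫ f = i₂ := by
  have hE : ValuativeCriterion.Existence f := by
    have h : UniversallyClosed f := inferInstance
    rw [UniversallyClosed.eq_valuativeCriterion] at h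
    exact h.1
  obtain ⟨⟨l, h1, h2⟩⟩ := (hE { R := A, K := K, i₁ := i₁, i₂ := i₂, commSq := ⟨w⟩ }).exists_lift
  exact ⟨l, h1, h2⟩

/-- **A morphism from the spectrum of a local ring lands in any open containing the image of the
closed point** (every point specialises to the closed point, and opens are stable under
generisation). [folklore] -/
theorem range_subset_of_closedPoint_mem {X : Scheme.{u}} {A : Type u} [CommRing A] [IsLocalRing A]
    (l : Spec (.of A) ⟶ X) (O : X.Opens) (h : l (IsLocalRing.closedPoint A) ∈ O) :
    Set.range l ⊆ (O : Set X) := by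
  rintro _ ⟨t, rfl⟩
  have hs : l t ⤳ l (IsLocalRing.closedPoint A) := (IsLocalRing.specializes_closedPoint t).map l.continuous
  exact hs.mem_open O.2 h

/-- **The image of a closed immersion is stable under specialisation.** [folklore] -/
theorem mem_range_of_specializes {X Y : Scheme.{u}} (c : X ⟶ Y) [IsClosedImmersion c] {y y' : Y}
    (hy : y ∈ Set.range c) (h : y ⤳ y') : y' ∈ Set.range c :=
  h.mem_closed c.isClosedEmbedding.isClosed_range hy

/-! ## Stacks 0F40 -/

section Main

variable {U S : Scheme.{u}} [IsNoetherian S] (g : U ⟶ S) [IsSeparated g] [LocallyOfFiniteType g]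
  [QuasiCompact g] (U₁ U₂ : U.Opens)

/-- Schemes of finite type over a Noetherian scheme are Noetherian. [folklore] -/
theorem isNoetherian_of_locallyOfFiniteType {X : Scheme.{u}} (f : X ⟶ S) [LocallyOfFiniteType f]
    [QuasiCompact f] : IsNoetherian X :=
  haveI : IsLocallyNoetherian X := LocallyOfFiniteType.isLocallyNoetherian f
  haveI : CompactSpace X := QuasiCompact.compactSpace_of_compactSpace f
  { }

/-- **Stacks 0F40 (the two-piece compactification lemma), conditional on Raynaud–Gruson
flattening (`Stacks081R`).** Let `S` be Noetherian, `g : U → S` separated of finite type,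
`U = U₁ ∪ U₂` opens with `U₁ ∩ U₂` dense in `U`, and assume `U₁ → S` and `U₂ → S` have
compactifications. Then `U → S` has a compactification. [cite: StacksProject, Tag 0F40] -/
theorem exists_compactification_of_twoPiece_of_stacks081R (hRG : Stacks081R.{u}) (hcov : U₁ ⊔ U₂ = ⊤)
    (hdense : Dense ((U₁ ⊓ U₂ : U.Opens) : Set U))
    (h₁ : ∃ (Y : Scheme.{u}) (j : (U₁ : Scheme.{u}) ⟶ Y) (π : Y ⟶ S),
      IsOpenImmersion j ∧ IsProper π ∧ j ≫ π = U₁.ι ≫ g)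
    (h₂ : ∃ (Y : Scheme.{u}) (j : (U₂ : Scheme.{u}) ⟶ Y) (π : Y ⟶ S),
      IsOpenImmersion j ∧ IsProper π ∧ j ≫ π = U₂.ι ≫ g) :
    ∃ (Y : Scheme.{u}) (j : U ⟶ Y) (π : Y ⟶ S), IsOpenImmersion j ∧ IsProper π ∧ j ≫ π = g := by
  haveI : IsNoetherian U := isNoetherian_of_locallyOfFiniteType g
  have hU₁ : IsCompact (U₁ : Set U) := NoetherianSpace.isCompact _
  have hU₂ : IsCompact (U₂ : Set U) := NoetherianSpace.isCompact _
  /- Step 1: extension data (Tag 0F3Z) and the two reductions (Tags 0F3V, 0F3W, 0F3Y) -/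
  obtain ⟨E₁⟩ := ExtData.nonempty_of_compactification hRG g U₁ hU₁ h₁
  obtain ⟨E₂⟩ := ExtData.nonempty_of_compactification hRG g U₂ hU₂ h₂
  have hV : ∀ (Ui : U.Opens) (E : ExtData g Ui), IsCompact (E.V : Set E.X) := fun Ui E => by
    haveI : IsNoetherian E.X := isNoetherian_of_locallyOfFiniteType E.πX
    exact NoetherianSpace.isCompact _
  obtain ⟨F₁, F₂, hempty⟩ := ExtData.exists_goodPair (g := g) hRG hcov hU₁ hU₂ E₁ E₂ hV
  haveI : IsNoetherian F₁.X := isNoetherian_of_locallyOfFiniteType F₁.πX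
  haveI : IsNoetherian F₂.X := isNoetherian_of_locallyOfFiniteType F₂.πX
  /- Step 2: the pieces `Wᵢ = U ⨿_{Uᵢ} Xᵢ°` (Tag 0F3U), separated and of finite type over `S` -/
  haveI : CompactSpace (F₁.core : Scheme.{u}) := isCompact_iff_compactSpace.mp (NoetherianSpace.isCompact _)
  haveI : CompactSpace (F₂.core : Scheme.{u}) := isCompact_iff_compactSpace.mp (NoetherianSpace.isCompact _)
  haveI : QuasiCompact F₁.pieceDesc := Limits.quasiCompact_pushoutDesc _ _ _ _ _
  haveI : QuasiCompact F₂.pieceDesc := Limits.quasiCompact_pushoutDesc _ _ _ _ _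
  haveI : QuasiCompact (pushout.inl U₁.ι F₁.jCore) := by
    haveI : QuasiSeparatedSpace F₁.piece := quasiSeparatedSpace_of_quasiSeparated F₁.pieceDesc
    infer_instance
  /- Step 3: Tag 0F3X for `U ⊆ W₁, W₂` -/
  obtain ⟨D⟩ := stacks0F3X_of_stacks081R F₁.pieceDesc F₂.pieceDesc (pushout.inl U₁.ι F₁.jCore)
    (pushout.inl U₂.ι F₂.jCore) (by rw [ExtData.inl_pieceDesc, ExtData.inl_pieceDesc]) hRG
  haveI := D.isOpenImmersion₁
  haveI := D.isOpenImmersion₂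
  haveI := D.isSeparated
  haveI := D.locallyOfFiniteType
  haveI := D.quasiCompact
  haveI := D.isOpenImmersion_u₁'
  haveI := D.isOpenImmersion_u₂'
  haveI : IsProper D.b₁ := IsBlowup.isProper_of_fg D.fg₁ D.isBlowup₁
  haveI : IsProper D.b₂ := IsBlowup.isProper_of_fg D.fg₂ D.isBlowup₂
  -- the structure morphisms: `uᵢ' ≫ iᵢ ≫ g_X = g`
  have hg₁ : D.u₁' ≫ D.i₁ ≫ D.g = g := by
    rw [D.i₁_g, ← Category.assoc, D.u₁'_b₁, ExtData.inl_pieceDesc]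
  have hg₂ : D.u₂' ≫ D.i₂ ≫ D.g = g := by
    rw [D.i₂_g, ← Category.assoc, D.u₂'_b₂, ExtData.inl_pieceDesc]
  /- Step 4: `U₁ ∩ U₂ → X` has dense image (all blowing ups are normalised) -/
  set h : ((U₁ ⊓ U₂ : U.Opens) : Scheme.{u}) ⟶ D.X := (U₁ ⊓ U₂).ι ≫ D.u₁' ≫ D.i₁ with hh
  haveI : CompactSpace D.X := QuasiCompact.compactSpace_of_compactSpace D.g
  haveI : QuasiSeparatedSpace D.X := quasiSeparatedSpace_of_quasiSeparated D.g
  haveI : CompactSpace ((U₁ ⊓ U₂ : U.Opens) : Scheme.{u}) :=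
    isCompact_iff_compactSpace.mp (NoetherianSpace.isCompact _)
  haveI : QuasiCompact h := inferInstance
  -- `uᵢ'(U)` is dense in `Xᵢ'`
  have hrange : ∀ {W W' : Scheme.{u}} (u : U ⟶ W) [IsOpenImmersion u] (u' : U ⟶ W') (b : W' ⟶ W)
      (Q : W.IdealSheafData), u' ≫ b = u → IsBlowup b Q → (Q.support : Set W) = (Set.range u)ᶜ →
      Dense (Set.range u') := by
    intro W W' u _ u' b Q hu'b hb hQ
    have hQ' : (Q.support : Set W) = ((u.opensRange : W.Opens) : Set W)ᶜ := by rw [hQ, Scheme.Hom.coe_opensRange]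
    obtain ⟨hqc, hsd⟩ := hb.quasiCompact_and_isSchemeTheoreticallyDominant_ι_preimage hQ'
    haveI := hqc
    haveI := hsd
    haveI : IsIso (b ∣_ u.opensRange) := hb.isIso_morphismRestrict_of_support_eq hQ'
    have hr : Set.range u' = ((b ⁻¹ᵁ u.opensRange : W'.Opens) : Set W') := by
      apply Set.Subset.antisymm
      · rintro _ ⟨x, rfl⟩
        show b (u' x) ∈ u.opensRange
        rw [← Scheme.Hom.comp_apply, hu'b]
        exact ⟨x, rfl⟩
      · intro x' hx'
        obtain ⟨x, hx⟩ := (id hx' : b x' ∈ Set.range u)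
        have h1 : b (u' x) = b x' := by rw [← Scheme.Hom.comp_apply, hu'b]; exact hx
        have h2 := (ConcreteCategory.bijective_of_isIso (b ∣_ u.opensRange).base).1
          (a₁ := ⟨u' x, show b (u' x) ∈ u.opensRange from h1 ▸ hx'⟩) (a₂ := ⟨x', hx'⟩)
          (Subtype.ext (by rw [morphismRestrict_base_coe, morphismRestrict_base_coe]; exact h1))
        exact ⟨x, congrArg Subtype.val h2⟩
    rw [hr, ← Scheme.Opens.range_ι]
    exact (b ⁻¹ᵁ u.opensRange).ι.denseRange
  have hd₁ : Dense (Set.range D.u₁') := hrange _ D.u₁' D.b₁ D.Q₁ D.u₁'_b₁ D.isBlowup₁ D.supp₁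
  have hd₂ : Dense (Set.range D.u₂') := hrange _ D.u₂' D.b₂ D.Q₂ D.u₂'_b₂ D.isBlowup₂ D.supp₂
  have hdU : DenseRange (D.u₁' ≫ D.i₁) := by
    rw [DenseRange, dense_iff_closure_eq, Set.eq_univ_iff_forall]
    intro x
    have hx : x ∈ Set.range D.i₁ ∪ Set.range D.i₂ := by rw [D.range_i₁_union_range_i₂]; trivial
    rcases hx with ⟨y, rfl⟩ | ⟨y, rfl⟩
    · have h1 : D.i₁ y ∈ D.i₁ '' closure (Set.range D.u₁') := ⟨y, by rw [hd₁.closure_eq]; trivial, rfl⟩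
      refine closure_mono ?_ (image_closure_subset_closure_image D.i₁.continuous h1)
      rintro _ ⟨_, ⟨t, rfl⟩, rfl⟩
      exact ⟨t, Scheme.Hom.comp_apply _ _ t⟩
    · have h1 : D.i₂ y ∈ D.i₂ '' closure (Set.range D.u₂') := ⟨y, by rw [hd₂.closure_eq]; trivial, rfl⟩
      refine closure_mono ?_ (image_closure_subset_closure_image D.i₂.continuous h1)
      rintro _ ⟨_, ⟨t, rfl⟩, rfl⟩
      refine ⟨t, ?_⟩
      rw [D.u₁'_i₁]
      exact Scheme.Hom.comp_apply _ _ t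
  have hdh : DenseRange h := by
    have e : Set.range h = (D.u₁' ≫ D.i₁) '' ((U₁ ⊓ U₂ : U.Opens) : Set U) := by
      rw [hh, Scheme.Hom.comp_base, TopCat.coe_comp, Set.range_comp, Scheme.Opens.range_ι]
    rw [DenseRange, e]
    exact hdU.dense_image (D.u₁' ≫ D.i₁).continuous hdense
  /- Step 5: the valuative lifts and properness of `X → S` (Tag 0894) -/
  have hproper : IsProper D.g := by
    refine isProper_of_valuativeCriterion_comp_of_denseRange h D.g hdh ?_
    intro A K _ _ _ _ _ _ uK sA hsq
    -- the `K`-point of `Uᵢ` and its extension `gᵢ : Spec A → Xᵢ` (valuative criterion for `Xᵢ → S`)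
    obtain ⟨uK₁, huK₁⟩ : ∃ u : Spec (.of K) ⟶ U₁, u = uK ≫ U.homOfLE inf_le_left := ⟨_, rfl⟩
    obtain ⟨uK₂, huK₂⟩ : ∃ u : Spec (.of K) ⟶ U₂, u = uK ≫ U.homOfLE inf_le_right := ⟨_, rfl⟩
    have huK₁' : uK₁ ≫ U₁.ι = uK ≫ (U₁ ⊓ U₂).ι := by rw [huK₁, Category.assoc, Scheme.homOfLE_ι]
    have huK₂' : uK₂ ≫ U₂.ι = uK ≫ (U₁ ⊓ U₂).ι := by rw [huK₂, Category.assoc, Scheme.homOfLE_ι]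
    have hsq' : uK ≫ (U₁ ⊓ U₂).ι ≫ g = Spec.map (CommRingCat.ofHom (algebraMap A K)) ≫ sA := by
      rw [← hsq, hh, Category.assoc, Category.assoc, hg₁]
    obtain ⟨l₁, hl₁K, hl₁A⟩ := exists_lift_of_universallyClosed F₁.πX (uK₁ ≫ F₁.jX) sA
      (by rw [Category.assoc, F₁.jX_πX, ← Category.assoc, huK₁', Category.assoc, hsq'])
    obtain ⟨l₂, hl₂K, hl₂A⟩ := exists_lift_of_universallyClosed F₂.πX (uK₂ ≫ F₂.jX) sA
      (by rw [Category.assoc, F₂.jX_πX, ← Category.assoc, huK₂', Category.assoc, hsq'])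
    -- the generic lift through `Wᵢ`, given that `lᵢ` lands in `Xᵢ°`
    have lift_through : ∀ (i : Bool), (cond i (l₁ (IsLocalRing.closedPoint A) ∈ F₁.core)
        (l₂ (IsLocalRing.closedPoint A) ∈ F₂.core)) →
        ∃ l : Spec (.of A) ⟶ D.X, Spec.map (CommRingCat.ofHom (algebraMap A K)) ≫ l = uK ≫ h ∧ l ≫ D.g = sA := by
      intro i hi
      cases i with
      | true =>
        -- `l₁` factors through `X₁°`, giving `Spec A → W₁`; lift along the proper `b₁ : W₁' → W₁`
        have hr := range_subset_of_closedPoint_mem l₁ F₁.core hi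
        set l₁' := IsOpenImmersion.lift F₁.core.ι l₁ (by rwa [Scheme.Opens.range_ι]) with hl₁'
        have hl₁'ι : l₁' ≫ F₁.core.ι = l₁ := IsOpenImmersion.lift_fac _ _ _
        have hK : Spec.map (CommRingCat.ofHom (algebraMap A K)) ≫ l₁' = uK₁ ≫ F₁.jCore := by
          rw [← cancel_mono F₁.core.ι, Category.assoc, hl₁'ι, hl₁K]
          simp only [Category.assoc, ExtData.jCore_ι]
        obtain ⟨m, hmK, hmA⟩ := exists_lift_of_universallyClosed D.b₁ (uK ≫ (U₁ ⊓ U₂).ι ≫ D.u₁')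
          (l₁' ≫ pushout.inr U₁.ι F₁.jCore) (by
            rw [Category.assoc, Category.assoc, D.u₁'_b₁, ← Category.assoc, ← huK₁', Category.assoc,
              pushout.condition, ← Category.assoc, ← hK, Category.assoc])
        refine ⟨m ≫ D.i₁, ?_, ?_⟩
        · rw [← Category.assoc, hmK, hh]
          simp only [Category.assoc]
        · rw [Category.assoc, D.i₁_g, ← Category.assoc, hmA, Category.assoc, ExtData.inr_pieceDesc,
            ← Category.assoc, hl₁'ι, hl₁A]
      | false =>
        have hr := range_subset_of_closedPoint_mem l₂ F₂.core hi
        set l₂' := IsOpenImmersion.lift F₂.core.ι l₂ (by rwa [Scheme.Opens.range_ι]) with hl₂'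
        have hl₂'ι : l₂' ≫ F₂.core.ι = l₂ := IsOpenImmersion.lift_fac _ _ _
        have hK : Spec.map (CommRingCat.ofHom (algebraMap A K)) ≫ l₂' = uK₂ ≫ F₂.jCore := by
          rw [← cancel_mono F₂.core.ι, Category.assoc, hl₂'ι, hl₂K]
          simp only [Category.assoc, ExtData.jCore_ι]
        obtain ⟨m, hmK, hmA⟩ := exists_lift_of_universallyClosed D.b₂ (uK ≫ (U₁ ⊓ U₂).ι ≫ D.u₂')
          (l₂' ≫ pushout.inr U₂.ι F₂.jCore) (by
            rw [Category.assoc, Category.assoc, D.u₂'_b₂, ← Category.assoc, ← huK₂', Category.assoc,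
              pushout.condition, ← Category.assoc, ← hK, Category.assoc])
        refine ⟨m ≫ D.i₂, ?_, ?_⟩
        · rw [← Category.assoc, hmK, hh, D.u₁'_i₁]
          simp only [Category.assoc]
        · rw [Category.assoc, D.i₂_g, ← Category.assoc, hmA, Category.assoc, ExtData.inr_pieceDesc,
            ← Category.assoc, hl₂'ι, hl₂A]
    by_cases hc₁ : l₁ (IsLocalRing.closedPoint A) ∈ F₁.core
    · exact lift_through true hc₁
    by_cases hc₂ : l₂ (IsLocalRing.closedPoint A) ∈ F₂.core
    · exact lift_through false hc₂
    -- both closed points in `Z̄₁,₂` resp. `Z̄₂,₁`: contradiction with `X₁₂ ∩ (Z̄₁,₂ ×_S Z̄₂,₁) = ∅`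
    exfalso
    rw [ExtData.mem_core_iff, not_not] at hc₁ hc₂
    -- the pair `(l₁, l₂) : Spec A → X₁ ×_S X₂` and its generic point in `V₁₂`
    set G : Spec (.of A) ⟶ pullback F₁.πX F₂.πX := pullback.lift l₁ l₂ (by rw [hl₁A, hl₂A]) with hG
    set vK : Spec (.of K) ⟶ pullback F₁.ψ F₂.ψ := pullback.lift (uK₁ ≫ F₁.sV) (uK₂ ≫ F₂.sV) (by
      simp only [Category.assoc, F₁.sV_ψ, F₂.sV_ψ, huK₁', huK₂']) with hvK
    have hgen : Spec.map (CommRingCat.ofHom (algebraMap A K)) ≫ G = vK ≫ ExtData.pairMap F₁ F₂ := by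
      apply pullback.hom_ext
      · rw [Category.assoc, hG, pullback.lift_fst, hl₁K, Category.assoc, ExtData.pairMap_fst, hvK,
          pullback.lift_fst_assoc, Category.assoc, F₁.sV_ι]
      · rw [Category.assoc, hG, pullback.lift_snd, hl₂K, Category.assoc, ExtData.pairMap_snd, hvK,
          pullback.lift_snd_assoc, Category.assoc, F₂.sV_ι]
    -- the closed point of `Spec A` maps into `X₁₂`
    have hmem : G (IsLocalRing.closedPoint A) ∈ Set.range (ExtData.pairMap F₁ F₂).imageι := by
      have h0 : G (Spec.map (CommRingCat.ofHom (algebraMap A K)) (IsLocalRing.closedPoint K)) ∈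
          Set.range (ExtData.pairMap F₁ F₂).imageι := by
        rw [← Scheme.Hom.comp_apply, hgen, Scheme.Hom.comp_apply]
        exact ⟨(ExtData.pairMap F₁ F₂).toImage (vK (IsLocalRing.closedPoint K)), by
          rw [← Scheme.Hom.comp_apply, Scheme.Hom.toImage_imageι]⟩
      exact mem_range_of_specializes _ h0
        (((IsLocalRing.specializes_closedPoint _).map G.continuous))
    obtain ⟨z, hz⟩ := hmem
    refine hempty z ?_ ?_
    · show ((ExtData.pairMap F₁ F₂).imageι ≫ pullback.fst F₁.πX F₂.πX) z ∈ _
      rw [Scheme.Hom.comp_apply, hz, ← Scheme.Hom.comp_apply, hG, pullback.lift_fst]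
      exact hc₁
    · show ((ExtData.pairMap F₁ F₂).imageι ≫ pullback.snd F₁.πX F₂.πX) z ∈ _
      rw [Scheme.Hom.comp_apply, hz, ← Scheme.Hom.comp_apply, hG, pullback.lift_snd]
      exact hc₂
  exact ⟨D.X, D.u₁' ≫ D.i₁, D.g, inferInstance, hproper, by rw [Category.assoc, hg₁]⟩

end Main

/-- Compactifiability transports along `W.ι⁻¹(W₁) → W₁`. [folklore] -/
theorem exists_compactification_preimage {X S : Scheme.{u}} (f : X ⟶ S) (W W₁ : X.Opens)
    (h : ∃ (Wc : Scheme.{u}) (j : (W₁ : Scheme.{u}) ⟶ Wc) (π : Wc ⟶ S),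
      IsOpenImmersion j ∧ IsProper π ∧ j ≫ π = W₁.ι ≫ f) :
    ∃ (Wc : Scheme.{u}) (j : ((W.ι ⁻¹ᵁ W₁ : W.toScheme.Opens) : Scheme.{u}) ⟶ Wc) (π : Wc ⟶ S),
      IsOpenImmersion j ∧ IsProper π ∧ j ≫ π = (W.ι ⁻¹ᵁ W₁).ι ≫ W.ι ≫ f := by
  obtain ⟨Wc, j, π, hj, hπ, hfac⟩ := h
  haveI := hj
  have hrange : Set.range ((W.ι ⁻¹ᵁ W₁).ι ≫ W.ι) ⊆ Set.range W₁.ι := by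
    rw [Scheme.Opens.range_ι]
    rintro _ ⟨x, rfl⟩
    exact x.2
  set i := IsOpenImmersion.lift W₁.ι ((W.ι ⁻¹ᵁ W₁).ι ≫ W.ι) hrange with hi
  have hiι : i ≫ W₁.ι = (W.ι ⁻¹ᵁ W₁).ι ≫ W.ι := IsOpenImmersion.lift_fac _ _ _
  haveI : IsOpenImmersion i := by
    have : IsOpenImmersion (i ≫ W₁.ι) := by rw [hiι]; infer_instance
    exact .of_comp _ W₁.ι
  exact ⟨Wc, i ≫ j, π, inferInstance, hπ, by rw [Category.assoc, hfac, ← Category.assoc, hiι, Category.assoc]⟩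

/-- **Stacks 0F40 in the shape of the hypothesis `h0F40` of
`exists_compactification_of_isNoetherian_of_twoPiece`** (`NagataCompactification.lean`), over a
Noetherian base: for opens `W = W₁ ∪ W₂` of a Noetherian separated `S`-scheme `X` locally of finite
type with `W₁ ∩ W₂` dense in `W` and `W₁, W₂` compactifiable over `S`, `W` is compactifiable over
`S`. [cite: StacksProject, Tag 0F40] -/
theorem h0F40_of_stacks081R (hRG : Stacks081R.{u}) {X S : Scheme.{u}} [IsNoetherian S] [IsNoetherian X]
    (f : X ⟶ S) [IsSeparated f] [LocallyOfFiniteType f] (W W₁ W₂ : X.Opens) (hW : W₁ ⊔ W₂ = W)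
    (hdense : Dense (W.ι ⁻¹' ((W₁ ⊓ W₂ : X.Opens) : Set X)))
    (h₁ : ∃ (Wc : Scheme.{u}) (j : (W₁ : Scheme.{u}) ⟶ Wc) (h : Wc ⟶ S),
      IsOpenImmersion j ∧ IsProper h ∧ j ≫ h = W₁.ι ≫ f)
    (h₂ : ∃ (Wc : Scheme.{u}) (j : (W₂ : Scheme.{u}) ⟶ Wc) (h : Wc ⟶ S),
      IsOpenImmersion j ∧ IsProper h ∧ j ≫ h = W₂.ι ≫ f) :
    ∃ (Wc : Scheme.{u}) (j : (W : Scheme.{u}) ⟶ Wc) (h : Wc ⟶ S),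
      IsOpenImmersion j ∧ IsProper h ∧ j ≫ h = W.ι ≫ f := by
  haveI : CompactSpace (W : Scheme.{u}) := isCompact_iff_compactSpace.mp (NoetherianSpace.isCompact _)
  haveI : QuasiCompact (W.ι ≫ f) := inferInstance
  have hcov : W.ι ⁻¹ᵁ W₁ ⊔ W.ι ⁻¹ᵁ W₂ = ⊤ := by
    refine top_le_iff.mp fun x _ => ?_
    have hx : x.1 ∈ (W₁ ⊔ W₂ : X.Opens) := by rw [hW]; exact x.2
    rcases hx with h | h
    · exact Or.inl h
    · exact Or.inr h
  exact exists_compactification_of_twoPiece_of_stacks081R (W.ι ≫ f) (W.ι ⁻¹ᵁ W₁) (W.ι ⁻¹ᵁ W₂) hRG hcov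
    hdense (exists_compactification_preimage f W W₁ h₁) (exists_compactification_preimage f W W₂ h₂)

end Literature.AlgebraicGeometry.Morphisms

end
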